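import Summits.NavierStokesRegularity.NavierStokesRegularity.Theorems.FilamentSkeletonRssDefectColumnGateDefsRacc
import Summits.NavierStokesRegularity.NavierStokesRegularity.Theses.FilamentSkeletonRss

/-!
# Route `FilamentSkeletonRss` · line `defect_column_gate_1AR_acc` → «acc-MOD» (R8): the line-side vocabulary with the EXPORT LAW STRUCK (v3.2-mod, files-only DRAFT)

LEAD ns-filament-21221-p1 g13, after R8 (`Lines/defect_column_gate_1AR_acc_R8.md`): the exported affine area law (`k₀ ≤ k ∧ Γ·|B − k·F⁰| ≤ Ce`) cannot be earned — the
area-law defect is a zero-mass sectional mode and the accretion multiplier is pinned to the `e^{−cΓ}` leak — so the closable-and-honest ∀-shape is the accretion memo's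
ORIGINAL §8: reduction MODULO the rate mode and the `N` accretion modes with `(g, B)` continuous OUTPUTS and NO statement about `B`'s size or sign (the sign/zero of `B` =
the physical feeding balance, to be filed explicitly on the ∃-side or as the route's negative endpoint).  This file is `…DefsRacc` (p679981) with every export-law field
deleted and NEW names (`…Mod`): `BoxConclMod`, `CutFormMod`, `FamilySpecMod`, `DefectFamilyMod`, `DefectGateMod`, `GateAssemblyLocMod`, `DefectClosingMod`; `BoxDef*`,
`BoxClauses1R`, `DefectGateSpecAcc`, `areaDefect`, `BoxFaces`, `BoxSkeletonR` are REUSED from `…DefsRacc` by name.  To be byte-aligned with tenure's retyped ∀-text if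
R8-2 is adopted.  HONEST FRAMING: bookkeeping for a HYPOTHETICAL blow-up route (MODEL rung, negative side); nothing here bears on Navier–Stokes regularity; no item filed.
-/

set_option linter.dupNamespace false

noncomputable section

namespace Summit.NavierStokesRegularity.NavierStokesRegularity.Theorems.DefectColumnGate

open scoped BigOperators Topology Manifold Classical MeasureTheory ProbabilityTheory Matrix InnerProductSpace ComplexConjugate ContinuousMap ENNReal ContDiff
open Filter Set Function TopologicalSpace MeasureTheory
open Literature.NS
open Literature.Analysis.FluidPDE
open Summit.NavierStokesRegularity.NavierStokesRegularity.Theses.FilamentSkeletonRss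
open Summit.NavierStokesRegularity.NavierStokesRegularity.Theorems.KelvinGate (lerayOp lerayLin XBound YBound LocClose)

/-! ## 0. The MOD-crux, cut at its arrows (hypothesis block = `…DefsRacc`'s `BoxDef*` / `BoxClauses1R`, reused by name) -/

/-- The CONCLUSION BLOCK of the MOD-crux for candidate outputs `(C₀, M, αo, g, B, Zr, U, P)` over the box times the abstract rate window `[−1, 1]`: joint continuity of `(g, B)`;
rate faces; at every `(p, β)` the profile equation at rate `αo p β ≠ 0` MODULO the rate mode `Zr` and the `N` accretion modes `D_pj` (`C²/C¹`, R7), with Type-I / pressure / waist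
envelopes — and NOTHING about `B`'s size or sign (R8). -/
def BoxConclMod (N : ℕ) (Γ ρ η Rw : ℝ) (X : (Fin N → ℝ) → Fin N → ℝ → EuclideanSpace ℝ (Fin 3))
    (u : (Fin N → ℝ) → (Fin N → ℝ → EuclideanSpace ℝ (Fin 3)) → EuclideanSpace ℝ (Fin 3) → EuclideanSpace ℝ (Fin 3))
    (D : (Fin N → ℝ) → Fin N → EuclideanSpace ℝ (Fin 3) → EuclideanSpace ℝ (Fin 3)) (C₀ M : ℝ) (αo g : (Fin N → ℝ) → ℝ → ℝ) (B : (Fin N → ℝ) → ℝ → Fin N → ℝ)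
    (Zr U : (Fin N → ℝ) → ℝ → EuclideanSpace ℝ (Fin 3) → EuclideanSpace ℝ (Fin 3)) (P : (Fin N → ℝ) → ℝ → EuclideanSpace ℝ (Fin 3) → ℝ) : Prop :=
  ContinuousOn (fun q:(Fin N→ℝ) × ℝ => (g q.1 q.2, B q.1 q.2)) ({p:Fin N → ℝ | ∀ i, p i ∈ Icc 0 1} ×ˢ Icc (-1) 1) ∧
  (∀ p:Fin N → ℝ, (∀ i, p i ∈ Icc 0 1) → g p (-1) < 0 ∧ 0 < g p 1) ∧
  (∀ (p:Fin N → ℝ) (β:ℝ), (∀ i, p i ∈ Icc 0 1) → β ∈ Icc (-1) 1 → αo p β ≠ 0 ∧ U p β ≠ 0 ∧ ContDiff ℝ 2 (U p β) ∧ ContDiff ℝ 1 (P p β) ∧ VectorCalculus.IsDivFree (U p β)∧(∀ y, αo p β•(cross (EuclideanSpace.single 2 1) (U p β y)-fderiv ℝ (U p β) y (cross (EuclideanSpace.single 2 1) y))+(1/2:ℝ)•U p β y+(1/2:ℝ)•fderiv ℝ (U p β) y y-(Laplacian.laplacian (U p β)) y+fderiv ℝ (U p β) y (U p β y)+gradient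 (P p β) y = g p β•Zr p β y+∑ j, B p β j•D p j y)∧(∀ y, ‖U p β y‖≤C₀/(1+‖y‖))∧(∀ y, |P p β y|≤M)∧(∀ y, ‖y‖≤Rw*√Γ → (∀ j τ, ρ*√Γ/4≤‖y-X p j τ‖) → ‖U p β y-u p (X p) y‖≤η*√Γ))

/-- The CUT FORM of the MOD-crux (R8-2 shape): for all box constants there is a threshold `Γ₁` such that every admissible p-family of clause-13-R skeleta carries outputs
satisfying `BoxConclMod`.  To be certified `↔` tenure's retyped route decl by `Iff.rfl` if R8-2 is adopted. -/
abbrev CutFormMod : Prop :=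
  ∀ (N : ℕ) (δ ρ K Λ a b cnd η Rw Rb cg θ₀ KA : ℝ), 0 < N → 0 < δ → 0 < ρ → 0 ≤ a → 0 < η → 0 < Rw → 0 < Rb → 0 < cg → 0 < θ₀ →
    ∃ Γ₁ : ℝ, ∀ Γ : ℝ, Γ₁ ≤ Γ →
    ∀ (γ : (Fin N → ℝ) → Fin N → ℝ) (α : (Fin N → ℝ) → ℝ) (X : (Fin N → ℝ) → Fin N → ℝ → EuclideanSpace ℝ (Fin 3)) (w : (Fin N → ℝ) → Fin N → ℝ → ℝ)
      (c : (Fin N → ℝ) → Fin N → ℝ) (m n : (Fin N → ℝ) → Fin N → EuclideanSpace ℝ (Fin 3)) (Aa : (Fin N → ℝ) → Fin N → ℝ → ℝ)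
      (u : (Fin N → ℝ) → (Fin N → ℝ → EuclideanSpace ℝ (Fin 3)) → EuclideanSpace ℝ (Fin 3) → EuclideanSpace ℝ (Fin 3))
      (v : (Fin N → ℝ) → EuclideanSpace ℝ (Fin 3) → EuclideanSpace ℝ (Fin 3)) (A : (Fin N → ℝ) → Fin N → (EuclideanSpace ℝ (Fin 3) →L[ℝ] EuclideanSpace ℝ (Fin 3)))
      (T : (Fin N → ℝ) → (Fin N → ℝ → EuclideanSpace ℝ (Fin 3)) → Fin N → ℝ → EuclideanSpace ℝ (Fin 3))
      (D : (Fin N → ℝ) → Fin N → EuclideanSpace ℝ (Fin 3) → EuclideanSpace ℝ (Fin 3)),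
      BoxDefU1 N Γ γ Aa u → BoxDefV1 N α X u v → BoxDefA1 N X c v A → BoxDefT1 N α u T → BoxDefD1 N X c D →
      BoxClauses1R N Γ δ ρ K Λ a b cnd Rw Rb cg θ₀ KA γ α X w c m n Aa v A T →
      ∃ (C₀ M : ℝ) (αo g : (Fin N → ℝ) → ℝ → ℝ) (B : (Fin N → ℝ) → ℝ → Fin N → ℝ) (Zr U : (Fin N → ℝ) → ℝ → EuclideanSpace ℝ (Fin 3) → EuclideanSpace ℝ (Fin 3))
        (P : (Fin N → ℝ) → ℝ → EuclideanSpace ℝ (Fin 3) → ℝ), BoxConclMod N Γ ρ η Rw X u D C₀ M αo g B Zr U P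

/-! ## 1. The specs of the line over the box -/

/-- **Spec of S1-mod · RE-WOUND DEFECT FAMILY of order `k` OVER THE BOX, residual split modulo the `N + 1` modes (NO export law, R8).**  For every `p` in the cube: `FamilySpec1AG`'s
clauses at the skeleton `p` (base rate `α⁰_p`, physical window `|β| ≤ β₀` with `0 < β₀ ≤ min(θ₀/4, 2Γ^(−q₁))` UNIFORM in `p`, smooth divergence-free `U⁰_{p,β}`,
size `Cs·Γ⁴`, non-degenerate, waist-close, compactly supported rate column `Z_{p,β} = 𝓡U⁰_{p,β}` in the doubled ball), EXCEPT that the profile equation at rate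
`α⁰_p + β` holds up to `r + g·Z + Σ_j G_j·D_pj` with `Y(r) ≤ C_r·Γ^(−k)`, `|g| ≤ Cs·Γ^(−q₁)` (the accretion coefficients `G_j` are free outputs — by R8 they are
`O(e^{−cΓ}·poly + Γ^{−k})` for every polynomial dressing); the rate defect has ONE orientation on the whole box with
margin `Γ^(−q₁)` at `β = ∓β₀`; and `(U⁰, Z, r, g, G)` are locally continuous in `(p, β)` jointly (sup on balls for the fields). -/
def FamilySpecMod (N : ℕ) (Γ ρ η Rw Rb θ₀ : ℝ) (k : ℕ) (Cs Cr q₁ : ℝ)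
    (α : (Fin N → ℝ) → ℝ) (X : (Fin N → ℝ) → Fin N → ℝ → EuclideanSpace ℝ (Fin 3))
    (u : (Fin N → ℝ) → (Fin N → ℝ → EuclideanSpace ℝ (Fin 3)) → EuclideanSpace ℝ (Fin 3) → EuclideanSpace ℝ (Fin 3))
    (D : (Fin N → ℝ) → Fin N → EuclideanSpace ℝ (Fin 3) → EuclideanSpace ℝ (Fin 3))
    (α0 : (Fin N → ℝ) → ℝ) (β₀ : ℝ) (U0 : (Fin N → ℝ) → ℝ → EuclideanSpace ℝ (Fin 3) → EuclideanSpace ℝ (Fin 3)) (P0 : (Fin N → ℝ) → ℝ → EuclideanSpace ℝ (Fin 3) → ℝ)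
    (Z : (Fin N → ℝ) → ℝ → EuclideanSpace ℝ (Fin 3) → EuclideanSpace ℝ (Fin 3)) (g : (Fin N → ℝ) → ℝ → ℝ) (G : (Fin N → ℝ) → ℝ → Fin N → ℝ)
    (r : (Fin N → ℝ) → ℝ → EuclideanSpace ℝ (Fin 3) → EuclideanSpace ℝ (Fin 3)) : Prop :=
  0 < β₀ ∧ β₀ ≤ θ₀ / 4 ∧ β₀ ≤ 2 * Γ ^ (-q₁) ∧
  ((∀ p : Fin N → ℝ, (∀ i, p i ∈ Icc (0:ℝ) 1) → g p (-β₀) ≤ -Γ ^ (-q₁) ∧ Γ ^ (-q₁) ≤ g p β₀) ∨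
    (∀ p : Fin N → ℝ, (∀ i, p i ∈ Icc (0:ℝ) 1) → g p β₀ ≤ -Γ ^ (-q₁) ∧ Γ ^ (-q₁) ≤ g p (-β₀))) ∧
  ∀ p : Fin N → ℝ, (∀ i, p i ∈ Icc (0:ℝ) 1) →
    |α0 p - α p| ≤ θ₀ / 4 ∧
    (∀ β : ℝ, |β| ≤ β₀ →
      ContDiff ℝ (⊤:ℕ∞) (U0 p β) ∧ ContDiff ℝ (⊤:ℕ∞) (P0 p β) ∧ VectorCalculus.IsDivFree (U0 p β) ∧
      XBound (U0 p β) (Cs * Γ ^ 4) ∧ (∀ y, |P0 p β y| ≤ Cs * Γ ^ 4) ∧ (∃ y₀, ‖y₀‖ ≤ Cs ∧ 1 ≤ ‖U0 p β y₀‖) ∧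
      (∀ y, ‖y‖ ≤ Rw * √Γ → (∀ j τ, ρ * √Γ / 4 ≤ ‖y - X p j τ‖) → ‖U0 p β y - u p (X p) y‖ ≤ η * √Γ / 2) ∧
      YBound (Z p β) (Cs * Γ ^ 6) ∧ (∀ y, ‖y‖ ≤ 2 * Rb * √(Γ * Real.log Γ) → Z p β y = rateGen (U0 p β) y) ∧
      (∀ y, 4 * Rb * √(Γ * Real.log Γ) ≤ ‖y‖ → Z p β y = 0) ∧
      YBound (r p β) (Cr * Γ ^ (-(k:ℝ))) ∧ |g p β| ≤ Cs * Γ ^ (-q₁) ∧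
      (∀ y, lerayOp (α0 p + β) (U0 p β) y + gradient (P0 p β) y = r p β y + g p β • Z p β y + ∑ j, G p β j • D p j y)) ∧
    (∀ β : ℝ, |β| ≤ β₀ → ∀ L ε : ℝ, 0 < ε → ∃ δ' : ℝ, 0 < δ' ∧ ∀ p' : Fin N → ℝ, (∀ i, p' i ∈ Icc (0:ℝ) 1) → ∀ β' : ℝ, |β'| ≤ β₀ →
      dist p' p < δ' → |β' - β| < δ' →
      LocClose (U0 p' β') (U0 p β) L ε ∧ LocClose (Z p' β') (Z p β) L ε ∧ (∀ y, ‖y‖ ≤ L → ‖r p' β' y - r p β y‖ ≤ ε) ∧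
        |g p' β' - g p β| ≤ ε ∧ ∀ j, |G p' β' j - G p β j| ≤ ε)

/-! ## 2. The statements of the MOD-line (S2a-loc `WaistColumnGateLoc1A` and the gate spec `DefectGateSpecAcc` are reused unchanged) -/

/-- **Statement of stub S1-mod · `DefectFamilyMod`** (size XL): existence of the re-wound defect family over the box, with a size constant `Cs` uniform in the requested
window exponent `q₁` and order `k` (the residual constant `C_r` and the threshold `Γ₁` may depend on them); no export law. -/
def DefectFamilyMod : Prop :=
  ∀ (N : ℕ) (δ ρ K Λ a b cnd η Rw Rb cg θ₀ KA : ℝ), 0 < N → 0 < δ → 0 < ρ → 0 ≤ a → 0 < η → 0 < Rw → 0 < Rb → 0 < cg → 0 < θ₀ →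
    ∃ Cs : ℝ, ∀ (q₁ : ℝ) (k : ℕ), ∃ Cr Γ₁ : ℝ, ∀ Γ : ℝ, Γ₁ ≤ Γ →
    ∀ (γ : (Fin N → ℝ) → Fin N → ℝ) (α : (Fin N → ℝ) → ℝ) (X : (Fin N → ℝ) → Fin N → ℝ → EuclideanSpace ℝ (Fin 3)) (w : (Fin N → ℝ) → Fin N → ℝ → ℝ)
      (c : (Fin N → ℝ) → Fin N → ℝ) (m n : (Fin N → ℝ) → Fin N → EuclideanSpace ℝ (Fin 3)) (Aa : (Fin N → ℝ) → Fin N → ℝ → ℝ)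
      (u : (Fin N → ℝ) → (Fin N → ℝ → EuclideanSpace ℝ (Fin 3)) → EuclideanSpace ℝ (Fin 3) → EuclideanSpace ℝ (Fin 3))
      (v : (Fin N → ℝ) → EuclideanSpace ℝ (Fin 3) → EuclideanSpace ℝ (Fin 3)) (A : (Fin N → ℝ) → Fin N → (EuclideanSpace ℝ (Fin 3) →L[ℝ] EuclideanSpace ℝ (Fin 3)))
      (T : (Fin N → ℝ) → (Fin N → ℝ → EuclideanSpace ℝ (Fin 3)) → Fin N → ℝ → EuclideanSpace ℝ (Fin 3))
      (D : (Fin N → ℝ) → Fin N → EuclideanSpace ℝ (Fin 3) → EuclideanSpace ℝ (Fin 3)),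
      BoxDefU1 N Γ γ Aa u → BoxDefV1 N α X u v → BoxDefA1 N X c v A → BoxDefT1 N α u T → BoxDefD1 N X c D →
      BoxClauses1R N Γ δ ρ K Λ a b cnd Rw Rb cg θ₀ KA γ α X w c m n Aa v A T →
      ∃ (α0 : (Fin N → ℝ) → ℝ) (β₀ : ℝ) (U0 : (Fin N → ℝ) → ℝ → EuclideanSpace ℝ (Fin 3) → EuclideanSpace ℝ (Fin 3)) (P0 : (Fin N → ℝ) → ℝ → EuclideanSpace ℝ (Fin 3) → ℝ)
        (Z : (Fin N → ℝ) → ℝ → EuclideanSpace ℝ (Fin 3) → EuclideanSpace ℝ (Fin 3)) (g : (Fin N → ℝ) → ℝ → ℝ) (G : (Fin N → ℝ) → ℝ → Fin N → ℝ)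
        (r : (Fin N → ℝ) → ℝ → EuclideanSpace ℝ (Fin 3) → EuclideanSpace ℝ (Fin 3)),
        FamilySpecMod N Γ ρ η Rw Rb θ₀ k Cs Cr q₁ α X u D α0 β₀ U0 P0 Z g G r

/-- **Conclusion of stub S2b-mod · `DefectGateMod`**: around EVERY defect family over the box with window exponent `q₁ ≥ q₀` and order `k ≥ k₀'` there is a gate
bordered by the rate column and the `N` modes (spec `DefectGateSpecAcc`, unchanged), with `κ, C₂` depending on the box constants and `Cs` only. -/
def DefectGateMod : Prop :=
  ∀ (N : ℕ) (δ ρ K Λ a b cnd η Rw Rb cg θ₀ KA : ℝ), 0 < N → 0 < δ → 0 < ρ → 0 ≤ a → 0 < η → 0 < Rw → 0 < Rb → 0 < cg → 0 < θ₀ →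
    ∀ Cs : ℝ, ∃ κ C₂ q₀ : ℝ, ∃ k₀' : ℕ, ∀ q₁ : ℝ, q₀ ≤ q₁ → ∀ k : ℕ, k₀' ≤ k → 1 ≤ k → ∀ Cr : ℝ, ∃ Γ₁ : ℝ, ∀ Γ : ℝ, Γ₁ ≤ Γ →
    ∀ (γ : (Fin N → ℝ) → Fin N → ℝ) (α : (Fin N → ℝ) → ℝ) (X : (Fin N → ℝ) → Fin N → ℝ → EuclideanSpace ℝ (Fin 3)) (w : (Fin N → ℝ) → Fin N → ℝ → ℝ)
      (c : (Fin N → ℝ) → Fin N → ℝ) (m n : (Fin N → ℝ) → Fin N → EuclideanSpace ℝ (Fin 3)) (Aa : (Fin N → ℝ) → Fin N → ℝ → ℝ)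
      (u : (Fin N → ℝ) → (Fin N → ℝ → EuclideanSpace ℝ (Fin 3)) → EuclideanSpace ℝ (Fin 3) → EuclideanSpace ℝ (Fin 3))
      (v : (Fin N → ℝ) → EuclideanSpace ℝ (Fin 3) → EuclideanSpace ℝ (Fin 3)) (A : (Fin N → ℝ) → Fin N → (EuclideanSpace ℝ (Fin 3) →L[ℝ] EuclideanSpace ℝ (Fin 3)))
      (T : (Fin N → ℝ) → (Fin N → ℝ → EuclideanSpace ℝ (Fin 3)) → Fin N → ℝ → EuclideanSpace ℝ (Fin 3))
      (D : (Fin N → ℝ) → Fin N → EuclideanSpace ℝ (Fin 3) → EuclideanSpace ℝ (Fin 3)),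
      BoxDefU1 N Γ γ Aa u → BoxDefV1 N α X u v → BoxDefA1 N X c v A → BoxDefT1 N α u T → BoxDefD1 N X c D →
      BoxClauses1R N Γ δ ρ K Λ a b cnd Rw Rb cg θ₀ KA γ α X w c m n Aa v A T →
      ∀ (α0 : (Fin N → ℝ) → ℝ) (β₀ : ℝ) (U0 : (Fin N → ℝ) → ℝ → EuclideanSpace ℝ (Fin 3) → EuclideanSpace ℝ (Fin 3)) (P0 : (Fin N → ℝ) → ℝ → EuclideanSpace ℝ (Fin 3) → ℝ)
        (Z : (Fin N → ℝ) → ℝ → EuclideanSpace ℝ (Fin 3) → EuclideanSpace ℝ (Fin 3)) (g : (Fin N → ℝ) → ℝ → ℝ) (G : (Fin N → ℝ) → ℝ → Fin N → ℝ)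
        (r : (Fin N → ℝ) → ℝ → EuclideanSpace ℝ (Fin 3) → EuclideanSpace ℝ (Fin 3)),
        FamilySpecMod N Γ ρ η Rw Rb θ₀ k Cs Cr q₁ α X u D α0 β₀ U0 P0 Z g G r →
      ∃ (𝓚 : (Fin N → ℝ) → ℝ → (EuclideanSpace ℝ (Fin 3) → EuclideanSpace ℝ (Fin 3)) → EuclideanSpace ℝ (Fin 3) → EuclideanSpace ℝ (Fin 3))
        (𝓠 : (Fin N → ℝ) → ℝ → (EuclideanSpace ℝ (Fin 3) → EuclideanSpace ℝ (Fin 3)) → EuclideanSpace ℝ (Fin 3) → ℝ)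
        (𝓫 : (Fin N → ℝ) → ℝ → (EuclideanSpace ℝ (Fin 3) → EuclideanSpace ℝ (Fin 3)) → ℝ)
        (𝓬 : (Fin N → ℝ) → ℝ → (EuclideanSpace ℝ (Fin 3) → EuclideanSpace ℝ (Fin 3)) → Fin N → ℝ),
        DefectGateSpecAcc N Γ κ C₂ β₀ α0 U0 Z D 𝓚 𝓠 𝓫 𝓬

/-- **Statement of stub S2b-mod · `GateAssemblyLocMod`**: `WaistColumnGateLoc1A → DefectGateMod`. -/
def GateAssemblyLocMod : Prop :=
  WaistColumnGateLoc1A → DefectGateMod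

/-- **Statement of stub S3-mod · `DefectClosingMod`** (R8: no export transfer; otherwise as S3-acc) (size L; frozen contraction at each `(p, β)` + JOINT CONTINUITY of the `N + 1` multipliers + export transfer;
NO intermediate-value theorem — the Miranda selection is the route-level glue).  Given `Cs`, `k₀ > 0`, the gate's `κ, C₂` and ANY thresholds `q₀, k₀'`, SOME
`q₁ ≥ q₀` and `k ≥ k₀'` suffice: for every family of that order over the box and every bordered gate around it, for `Γ ≥ Γ₁`, the outputs
`αo := α⁰_p + β₀b`, `U := U⁰ + 𝓚G`, `P := P⁰ + 𝓠G`, `(g', B) := ±(g − 𝓫G, ·), (G_j − 𝓬_jG)_j`, `Zr := ±Z` (sign = the family's orientation), `k := kA`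
satisfy `BoxConclMod`, where `G_{p,β}` is the Picard fixed point `G = −r − D(𝓚G)[𝓚G]` in the `2C_rΓ^(−k)`-ball. -/
def DefectClosingMod : Prop :=
  ∀ (N : ℕ) (δ ρ K Λ a b cnd η Rw Rb cg θ₀ KA : ℝ), 0 < N → 0 < δ → 0 < ρ → 0 ≤ a → 0 < η → 0 < Rw → 0 < Rb → 0 < cg → 0 < θ₀ →
    ∀ Cs κ C₂ q₀ : ℝ, ∀ k₀' : ℕ, ∃ q₁ : ℝ, q₀ ≤ q₁ ∧ ∃ k : ℕ, k₀' ≤ k ∧ 1 ≤ k ∧ ∀ Cr : ℝ, ∃ Γ₁ : ℝ, ∀ Γ : ℝ, Γ₁ ≤ Γ →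
    ∀ (γ : (Fin N → ℝ) → Fin N → ℝ) (α : (Fin N → ℝ) → ℝ) (X : (Fin N → ℝ) → Fin N → ℝ → EuclideanSpace ℝ (Fin 3)) (w : (Fin N → ℝ) → Fin N → ℝ → ℝ)
      (c : (Fin N → ℝ) → Fin N → ℝ) (m n : (Fin N → ℝ) → Fin N → EuclideanSpace ℝ (Fin 3)) (Aa : (Fin N → ℝ) → Fin N → ℝ → ℝ)
      (u : (Fin N → ℝ) → (Fin N → ℝ → EuclideanSpace ℝ (Fin 3)) → EuclideanSpace ℝ (Fin 3) → EuclideanSpace ℝ (Fin 3))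
      (v : (Fin N → ℝ) → EuclideanSpace ℝ (Fin 3) → EuclideanSpace ℝ (Fin 3)) (A : (Fin N → ℝ) → Fin N → (EuclideanSpace ℝ (Fin 3) →L[ℝ] EuclideanSpace ℝ (Fin 3)))
      (T : (Fin N → ℝ) → (Fin N → ℝ → EuclideanSpace ℝ (Fin 3)) → Fin N → ℝ → EuclideanSpace ℝ (Fin 3))
      (D : (Fin N → ℝ) → Fin N → EuclideanSpace ℝ (Fin 3) → EuclideanSpace ℝ (Fin 3)),
      BoxDefU1 N Γ γ Aa u → BoxDefV1 N α X u v → BoxDefA1 N X c v A → BoxDefT1 N α u T → BoxDefD1 N X c D →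
      BoxClauses1R N Γ δ ρ K Λ a b cnd Rw Rb cg θ₀ KA γ α X w c m n Aa v A T →
      ∀ (α0 : (Fin N → ℝ) → ℝ) (β₀ : ℝ) (U0 : (Fin N → ℝ) → ℝ → EuclideanSpace ℝ (Fin 3) → EuclideanSpace ℝ (Fin 3)) (P0 : (Fin N → ℝ) → ℝ → EuclideanSpace ℝ (Fin 3) → ℝ)
        (Z : (Fin N → ℝ) → ℝ → EuclideanSpace ℝ (Fin 3) → EuclideanSpace ℝ (Fin 3)) (g : (Fin N → ℝ) → ℝ → ℝ) (G : (Fin N → ℝ) → ℝ → Fin N → ℝ)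
        (r : (Fin N → ℝ) → ℝ → EuclideanSpace ℝ (Fin 3) → EuclideanSpace ℝ (Fin 3)),
        FamilySpecMod N Γ ρ η Rw Rb θ₀ k Cs Cr q₁ α X u D α0 β₀ U0 P0 Z g G r →
      ∀ (𝓚 : (Fin N → ℝ) → ℝ → (EuclideanSpace ℝ (Fin 3) → EuclideanSpace ℝ (Fin 3)) → EuclideanSpace ℝ (Fin 3) → EuclideanSpace ℝ (Fin 3))
        (𝓠 : (Fin N → ℝ) → ℝ → (EuclideanSpace ℝ (Fin 3) → EuclideanSpace ℝ (Fin 3)) → EuclideanSpace ℝ (Fin 3) → ℝ)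
        (𝓫 : (Fin N → ℝ) → ℝ → (EuclideanSpace ℝ (Fin 3) → EuclideanSpace ℝ (Fin 3)) → ℝ)
        (𝓬 : (Fin N → ℝ) → ℝ → (EuclideanSpace ℝ (Fin 3) → EuclideanSpace ℝ (Fin 3)) → Fin N → ℝ),
        DefectGateSpecAcc N Γ κ C₂ β₀ α0 U0 Z D 𝓚 𝓠 𝓫 𝓬 →
      ∃ (C₀ M : ℝ) (αo g' : (Fin N → ℝ) → ℝ → ℝ) (B : (Fin N → ℝ) → ℝ → Fin N → ℝ) (Zr U : (Fin N → ℝ) → ℝ → EuclideanSpace ℝ (Fin 3) → EuclideanSpace ℝ (Fin 3))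
        (P : (Fin N → ℝ) → ℝ → EuclideanSpace ℝ (Fin 3) → ℝ), BoxConclMod N Γ ρ η Rw X u D C₀ M αo g' B Zr U P

end Summit.NavierStokesRegularity.NavierStokesRegularity.Theorems.DefectColumnGate

end


/-! ## Tenure-facing literal text of the NO-EXPORT ∀-item (R8-2 / dss_126 T1) and its `Iff.rfl` certificate against the line-side cut form `CutFormMod` -/

namespace Summit.NavierStokesRegularity.NavierStokesRegularity.Theses.FilamentSkeletonRss
open scoped BigOperators Topology Manifold Classical MeasureTheory ProbabilityTheory Matrix InnerProductSpace ComplexConjugate ContinuousMap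
open Filter Set Function TopologicalSpace MeasureTheory
open Literature.NS
namespace A1RnoexportScratch

/-- **∀-item «TR-acc-NOEXPORT» (LEAD g13 v3.2, R8-2; = tenure v5 `TransverseReduction1ARaccDraft` dd103c2a with the export constants `k₀ Ce`, the output `k` and the export conjunct
STRUCK; hypothesis block UNCHANGED incl. derivX; R7 C²/C¹):** every admissible p-family of clause-13-R skeleta over the core-area box reduces, MODULO the free rate mode `Zr` and the `N`
waist-accretion modes `D_pj`, to fields with jointly continuous multipliers `(g, B)`, rate faces, and the Type-I / pressure / waist envelopes — and NOTHING is claimed about `B`'s size or sign.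
SUPPORT/FRONTIER-type: it reaches `RssProfileExists` only together with a SELECTION statement on `B` (the physical feeding balance, T2/T3), so it is NOT a summit-live crux. -/
def TransverseReduction1ARnoexportDraft : Prop :=
  (open Literature.Analysis.FluidPDE in ∀ (N:ℕ) (δ ρ K Λ a b cnd η Rw Rb cg θ₀ KA:ℝ), 0 < N → 0 < δ → 0 < ρ → 0 ≤ a → 0 < η → 0 < Rw → 0 < Rb → 0 < cg → 0 < θ₀ → ∃ Γ₁:ℝ, ∀ Γ:ℝ, Γ₁≤Γ → ∀ (γ:(Fin N→ℝ) → Fin N → ℝ) (α:(Fin N→ℝ) → ℝ) (X:(Fin N→ℝ) → Fin N → ℝ → EuclideanSpace ℝ (Fin 3)) (w:(Fin N→ℝ) → Fin N → ℝ → ℝ) (c:(Fin N→ℝ) → Fin N → ℝ) (m n:(Fin N→ℝ) → Fin N → EuclideanSpace ℝ (Fin 3)) (Aa:(Fin N→ℝ) → Fin N → ℝ → ℝ) (u:(Fin N→ℝ)→(Fin N → ℝ → EuclideanSpace ℝ (Fin 3)) → EuclideanSpace ℝ (Fin 3) → EuclideanSpace ℝ (Fin 3)) (v:(Fin N→ℝ)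 → EuclideanSpace ℝ (Fin 3) → EuclideanSpace ℝ (Fin 3)) (A:(Fin N→ℝ) → Fin N → (EuclideanSpace ℝ (Fin 3) →L[ℝ] EuclideanSpace ℝ (Fin 3))) (T:(Fin N→ℝ)→(Fin N → ℝ → EuclideanSpace ℝ (Fin 3)) → Fin N → ℝ → EuclideanSpace ℝ (Fin 3)) (D:(Fin N→ℝ) → Fin N → EuclideanSpace ℝ (Fin 3) → EuclideanSpace ℝ (Fin 3)), (∀ p Z y, u p Z y = ∑ k, (Γ*γ p k/(4*Real.pi))•∫ σ:ℝ, ((‖y-Z k σ‖^2+Real.exp (-(1+Real.eulerMascheroniConstant-Real.log 2))*Aa p k σ)^(3/2:ℝ))⁻¹•cross (deriv (Z k) σ) (y-Z k σ))→(∀ p y, v p y = u p (X p) y+(1/2:ℝ)•y-α p•cross (EuclideanSpace.single 2 1) y)→(∀ p j, A p j = fderiv ℝ (v p) (X p j (c p j)))→(∀ p Z j τ, T p Z j τ = (u p Z (Z j τ)+(1/2:ℝ)•Z j τ-α p•cross (EuclideanSpace.single 2 1) (Z j τ))-(⟪u p Z (Z j τ)+(1/2:ℝ)•Z j τ-α p•cross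 (EuclideanSpace.single 2 1) (Z j τ), deriv (Z j) τ⟫_ℝ/‖deriv (Z j) τ‖^2)•deriv (Z j) τ)→(∀ p j y, D p j y = (Real.exp (-(⟪y-X p j (c p j), deriv (X p j) (c p j)⟫_ℝ)^2)*((1-Real.exp (-(‖y-X p j (c p j)‖^2-⟪y-X p j (c p j), deriv (X p j) (c p j)⟫_ℝ^2)))/(‖y-X p j (c p j)‖^2-⟪y-X p j (c p j), deriv (X p j) (c p j)⟫_ℝ^2)))•cross (deriv (X p j) (c p j)) (y-X p j (c p j)))→((∀ j, ContinuousOn (fun q:(Fin N→ℝ) × ℝ => (α q.1, γ q.1 j, c q.1 j, X q.1 j q.2, deriv (X q.1 j) q.2, w q.1 j q.2, Aa q.1 j q.2, m q.1 j, n q.1 j)) ({p:Fin N → ℝ | ∀ i, p i ∈ Icc 0 1} ×ˢ univ))∧(∀ p:Fin N → ℝ, (∀ i, p i ∈ Icc 0 1) → α p ≠ 0 ∧ (∀ j, γ p j ≠ 0)∧(∀ j, ContDiff ℝ 2 (X p j) ∧ Differentiable ℝ (w p j)∧(∀ τ, ‖deriv (X p j) τ‖ = 1)∧(∀ τ, ‖iteratedDeriv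 2 (X p j) τ‖*√Γ≤K) ∧ Tendsto (fun τ => ‖X p j τ‖) (cocompact ℝ) atTop)∧(∀ j k, j ≠ k → ∀ τ σ, ρ*√Γ≤‖X p j τ-X p k σ‖)∧(∀ j τ σ, ρ*√Γ≤|τ-σ| → cg*ρ*√Γ≤‖X p j τ-X p j σ‖)∧(∀ j τ, cg*|τ-c p j|≤Rw*√Γ+‖X p j τ‖)∧(∀ j τ, w p j τ = ⟪v p (X p j τ), deriv (X p j) τ⟫_ℝ)∧(∀ j τ, ‖X p j τ‖≤Rb*√(Γ*Real.log Γ) → v p (X p j τ) = w p j τ•deriv (X p j) τ)∧(∀ j, ‖X p j (c p j)‖≤Rw*√Γ)∧(∀ j, |⟪deriv (X p j) (c p j), EuclideanSpace.single 2 1⟫_ℝ|≤1-θ₀)∧(θ₀≤|α p| ∧ |α p|≤θ₀⁻¹ ∧ ∀ j, θ₀≤|γ p j| ∧ |γ p j|≤θ₀⁻¹)∧(∀ j, w p j (c p j) = 0 ∧ (∀ τ, w p j τ = 0 → τ = c p j) ∧ 3/2+δ≤deriv (w p j) (c p j) ∧ deriv (w p j) (c p j)≤Λ)∧(∀ j,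 Differentiable ℝ (Aa p j) ∧ (∀ τ, 0 < Aa p j τ) ∧ 1≤KA*Aa p j (c p j) ∧ ∀ τ, ‖X p j τ‖≤2*Rb*√(Γ*Real.log Γ) → Aa p j τ = Aa p j (c p j))∧(∀ j τ, Rw^2*Γ*Aa p j τ≤KA*(Rw^2*Γ+‖X p j τ‖^2))∧(∀ j, Orthonormal ℝ ![deriv (X p j) (c p j), m p j, n p j] ∧ ⟪A p j (m p j), m p j⟫_ℝ+⟪A p j (n p j), n p j⟫_ℝ < 0 ∧ ⟪A p j (n p j), m p j⟫_ℝ * ⟪A p j (m p j), n p j⟫_ℝ < ⟪A p j (m p j), m p j⟫_ℝ * ⟪A p j (n p j), n p j⟫_ℝ)∧(∀ Y:Fin N → ℝ → EuclideanSpace ℝ (Fin 3), (∀ j, ContDiff ℝ 2 (Y j))→(∀ j τ, ⟪Y j τ, deriv (X p j) τ⟫_ℝ = 0) → (∀ j τ, Rb*√(Γ*Real.log Γ) < ‖X p j τ‖ → Y j τ = 0) → ∑ j, ⟪Y j (c p j), cross (EuclideanSpace.single 2 1) (X p j (c p j))⟫_ℝ = 0 → (∀ j τ, ‖Y j τ‖+‖deriv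 (Y j) τ‖+‖iteratedDeriv 2 (Y j) τ‖≤(1+|τ-c p j|)^b) → ∀ dα L:ℝ, (∀ j τ, ‖X p j τ‖≤Rb*√(Γ*Real.log Γ) → ‖deriv (fun s:ℝ => T p (fun k σ => X p k σ+s•Y k σ) j τ) 0-dα•(cross (EuclideanSpace.single 2 1) (X p j τ)-⟪cross (EuclideanSpace.single 2 1) (X p j τ), deriv (X p j) τ⟫_ℝ•deriv (X p j) τ)‖≤L*(1+|τ-c p j|)^a) → (∀ j τ, ‖Y j τ‖≤cnd*L*(1+|τ-c p j|)^b) ∧ |dα| * √Γ≤cnd*L))) → ∃ (C₀ M:ℝ) (αo g:(Fin N→ℝ) → ℝ → ℝ) (B:(Fin N→ℝ) → ℝ → Fin N → ℝ) (Zr:(Fin N→ℝ) → ℝ → EuclideanSpace ℝ (Fin 3) → EuclideanSpace ℝ (Fin 3)) (U:(Fin N→ℝ) → ℝ → EuclideanSpace ℝ (Fin 3) → EuclideanSpace ℝ (Fin 3)) (P:(Fin N→ℝ) → ℝ → EuclideanSpace ℝ (Fin 3) → ℝ), ContinuousOn (fun q:(Fin N→ℝ) × ℝ => (g q.1 q.2,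 B q.1 q.2)) ({p:Fin N → ℝ | ∀ i, p i ∈ Icc 0 1} ×ˢ Icc (-1) 1) ∧ (∀ p:Fin N → ℝ, (∀ i, p i ∈ Icc 0 1) → g p (-1) < 0 ∧ 0 < g p 1) ∧ (∀ (p:Fin N → ℝ) (β:ℝ), (∀ i, p i ∈ Icc 0 1) → β ∈ Icc (-1) 1 → αo p β ≠ 0 ∧ U p β ≠ 0 ∧ ContDiff ℝ 2 (U p β) ∧ ContDiff ℝ 1 (P p β) ∧ VectorCalculus.IsDivFree (U p β)∧(∀ y, αo p β•(cross (EuclideanSpace.single 2 1) (U p β y)-fderiv ℝ (U p β) y (cross (EuclideanSpace.single 2 1) y))+(1/2:ℝ)•U p β y+(1/2:ℝ)•fderiv ℝ (U p β) y y-(Laplacian.laplacian (U p β)) y+fderiv ℝ (U p β) y (U p β y)+gradient (P p β) y = g p β•Zr p β y+∑ j, B p β j•D p j y)∧(∀ y, ‖U p β y‖≤C₀/(1+‖y‖))∧(∀ y, |P p β y|≤M)∧(∀ y, ‖y‖≤Rw*√Γ → (∀ j τ, ρ*√Γ/4≤‖y-X p j τ‖) → ‖U p β y-u p (X p) y‖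≤η*√Γ)))

/-- byte-test: the literal text unfolds to the line-side cut form by `Iff.rfl`. -/
example : TransverseReduction1ARnoexportDraft ↔ Summit.NavierStokesRegularity.NavierStokesRegularity.Theorems.DefectColumnGate.CutFormMod := Iff.rfl

end A1RnoexportScratch
end Summit.NavierStokesRegularity.NavierStokesRegularity.Theses.FilamentSkeletonRss
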